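import Summits.AtomisticToContinuum.Crystallization.Theorems.ChargedEnergyGapSphereRows
import HarnessLib

/-!
# NODE 113G «SlimBasis» — LP bases shipped as COLUMN REFERENCES ONLY; the kernel recomputes `B⁻¹`

The certificate files of the (T¹ᶜ) census (110E `StationCert`, 113B/113D/113F) spend 73–84 % of their bytes on the LP bases: each
110B `BasisCert` carries its six `ColRef`s AND the 36 exact rationals of `B⁻¹` (≈ 740 bytes), and a station needs 50–110 bases.
This DEF-ONLY node lets a file ship a basis as its six column references (`BasisIdx`, ≈ 60 bytes) and EXPANDS it to a `BasisCert`
inside the kernel: `BasisIdx.expand` assembles the 6×6 column matrix from the table `T75Q` exactly as 110E `BasisCert.invCheck` reads it,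
inverts it exactly (fraction-free Montante–Bareiss elimination over `ℤ` after scaling by the common denominator, `gjInverseZ`; lists only),
and fills the rows `r₀ … r₅`.

SOUNDNESS IS UNTOUCHED: the expanded object is an ordinary `BasisCert` inside an ordinary `StationCert`, so every soundness theorem
(110E `sound`, 113B `sound_diet`, 113D `sound_dietX`, 113F `sound_dietSph` / `SphUnit.sound`) applies verbatim; the elimination is NOT
trusted — were it wrong, `invCheck` (still run by the checker on the expanded rows) would reject the certificate.  A singular or
out-of-range basis expands to zero rows, which `invCheck` rejects.

Contents: `cegSlot6` (the slot order of `sextQ`), list helpers `rowSub`, `rowScale`, `pivotSplit`, `gjStep`, `gjLoop`, `gjInverse` (reference, over `ℚ`),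
`rowBareiss`, `pivotSplitZ`, `bmStep`, `bmLoop`, `slimLcmDen`, `gjInverseZ` (the fraction-free integer path `expand` uses);
`BasisIdx`, `BasisIdx.cols`, `colEntry?`, `BasisIdx.mat?`, `slimRowFun`, `BasisIdx.expand`, `expandAll`, `BasisCert.slim`; the byte-only alternative `cegRowZ`
(six numerators over one denominator); `decide +kernel` sanity checks on small matrices.  No instance, no notation, no `Prop`-valued definition.
-/

namespace Summit.AtomisticToContinuum.Crystallization.Theorems.ChargedEnergyGapChartDial

/-! ## §113G.1 Exact Gauss–Jordan inversion on lists of rationals -/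

/-- The six hole-vertex slots in the order of `sextQ`'s arguments: `(0,T) (0,F) (1,T) (1,F) (2,T) (2,F)`. -/
def cegSlot6 : List (Fin 3 × Bool) := [(0, true), (0, false), (1, true), (1, false), (2, true), (2, false)]

/-- `r - c • p`, entrywise on two rows of equal length. -/
def rowSub (r p : List ℚ) (c : ℚ) : List ℚ := List.zipWith (fun x y => x - c * y) r p

/-- `c • r`. -/
def rowScale (c : ℚ) (r : List ℚ) : List ℚ := r.map (fun x => c * x)

/-- Split a list of rows into (the first row whose entry `j` is nonzero, the rows before it, the rows after it), if any. -/
def pivotSplit (j : ℕ) : List (List ℚ) → Option (List ℚ × List (List ℚ) × List (List ℚ))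
  | [] => none
  | r :: rs =>
    if r.getD j 0 ≠ 0 then some (r, [], rs)
    else match pivotSplit j rs with
      | none => none
      | some (p, pre, post) => some (p, r :: pre, post)

/-- One elimination step on column `j`: the rows `done` are already reduced (pivots in columns `< j`), the pivot is searched among
`rest`; the pivot row is normalised and column `j` is cleared from every other row.  Returns the new (done, rest). -/
def gjStep (j : ℕ) (done rest : List (List ℚ)) : Option (List (List ℚ) × List (List ℚ)) :=
  match pivotSplit j rest with
  | none => none
  | some (p, pre, post) =>
    let q := rowScale (p.getD j 0)⁻¹ p
    let clear := fun r : List ℚ => rowSub r q (r.getD j 0)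
    some (done.map clear ++ [q], (pre ++ post).map clear)

/-- Eliminate columns `j, j+1, …, j+n-1`. -/
def gjLoop : ℕ → ℕ → List (List ℚ) → List (List ℚ) → Option (List (List ℚ))
  | 0, _, done, rest => if rest.isEmpty then some done else none
  | n + 1, j, done, rest =>
    match gjStep j done rest with
    | none => none
    | some (done', rest') => gjLoop n (j + 1) done' rest'

/-- ★ The exact inverse of a square matrix given as a list of `n` rows of length `n` (Gauss–Jordan on `[M | I]`), or `none` if singular. -/
def gjInverse (M : List (List ℚ)) : Option (List (List ℚ)) :=
  let n := M.length
  let aug := (List.range n).zipWith (fun i r => r ++ (List.range n).map (fun k => if k = i then (1 : ℚ) else 0)) M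
  match gjLoop n 0 [] aug with
  | none => none
  | some rows => some (rows.map (fun r => r.drop n))

/-- sanity: the inverse of `[[2, 1], [1, 1]]` is `[[1, -1], [-1, 2]]`. -/
theorem gjInverse_example : gjInverse [[2, 1], [1, 1]] = some [[1, -1], [-1, 2]] := by decide +kernel

/-! ## §113G.1b Fraction-free (Bareiss–Montante) Gauss–Jordan over `ℤ` — the fast path used by `expand`
Kernel `ℤ` arithmetic is ≈ 15× cheaper than normalising `ℚ` arithmetic; the matrix is first scaled to integers by a common denominator. -/

/-- `(piv • r - c • p) / prev`, entrywise (exact division in the Bareiss recurrence). -/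
def rowBareiss (piv c prev : ℤ) (r p : List ℤ) : List ℤ := List.zipWith (fun x y => (piv * x - c * y) / prev) r p

/-- First row whose entry `j` is nonzero, with the rows before and after it. -/
def pivotSplitZ (j : ℕ) : List (List ℤ) → Option (List ℤ × List (List ℤ) × List (List ℤ))
  | [] => none
  | r :: rs =>
    if r.getD j 0 ≠ 0 then some (r, [], rs)
    else match pivotSplitZ j rs with
      | none => none
      | some (p, pre, post) => some (p, r :: pre, post)

/-- One Montante step on column `j` with previous pivot `prev`: returns (new done, new rest, the pivot used). The pivot row is kept as is. -/
def bmStep (j : ℕ) (prev : ℤ) (done rest : List (List ℤ)) : Option (List (List ℤ) × List (List ℤ) × ℤ) :=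
  match pivotSplitZ j rest with
  | none => none
  | some (p, pre, post) =>
    let piv := p.getD j 0
    let clear := fun r : List ℤ => rowBareiss piv (r.getD j 0) prev r p
    some (done.map clear ++ [p], (pre ++ post).map clear, piv)

/-- Montante elimination of columns `j, …, j+n-1`; returns the reduced rows and the last pivot (= ± the determinant). -/
def bmLoop : ℕ → ℕ → ℤ → List (List ℤ) → List (List ℤ) → Option (List (List ℤ) × ℤ)
  | 0, _, prev, done, rest => if rest.isEmpty then some (done, prev) else none
  | n + 1, j, prev, done, rest =>
    match bmStep j prev done rest with
    | none => none
    | some (done', rest', piv) => bmLoop n (j + 1) piv done' rest'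

/-- The least common denominator of a list of rationals (as a natural number, `1` for the empty list). -/
def slimLcmDen (xs : List ℚ) : ℕ := xs.foldl (fun a x => Nat.lcm a x.den) 1

/-- ★ The exact inverse of a square rational matrix through integers: scale by the common denominator `D`, run Montante on `[A | I]`
(final left block `= d • I` with `d = ±det A`), and return the rows of `A⁻¹ = D • right / d`; `none` if singular. -/
def gjInverseZ (M : List (List ℚ)) : Option (List (List ℚ)) :=
  let n := M.length
  let D : ℤ := slimLcmDen M.flatten
  let A : List (List ℤ) := M.map (fun r => r.map (fun x : ℚ => (x * (D : ℚ)).num))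
  let aug := (List.range n).zipWith (fun i r => r ++ (List.range n).map (fun k => if k = i then (1 : ℤ) else 0)) A
  match bmLoop n 0 1 [] aug with
  | none => none
  | some (rows, d) => some (rows.map (fun r => (r.drop n).map (fun z => Rat.divInt (z * D) d)))

/-- sanity: the integer path inverts `[[2, 1], [1, 1]]` to `[[1, -1], [-1, 2]]` as well. -/
theorem gjInverseZ_example : gjInverseZ [[2, 1], [1, 1]] = some [[1, -1], [-1, 2]] := by decide +kernel

/-- sanity: a `3×3` with fractional entries — both paths agree. -/
theorem gjInverseZ_example3 :
    gjInverseZ [[1/2, 1/3, 0], [0, 1, 1/4], [2, 0, 1]] = gjInverse [[1/2, 1/3, 0], [0, 1, 1/4], [2, 0, 1]] := by decide +kernel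

/-! ## §113G.2 Column-only bases and their expansion -/

/-- ★ A SLIM BASIS: the six column references of an LP basis (110B `ColRef` = table row index, axis relabelling, pole-flip pattern). -/
structure BasisIdx where
  /-- column 0 -/
  c₀ : ColRef
  /-- column 1 -/
  c₁ : ColRef
  /-- column 2 -/
  c₂ : ColRef
  /-- column 3 -/
  c₃ : ColRef
  /-- column 4 -/
  c₄ : ColRef
  /-- column 5 -/
  c₅ : ColRef

/-- The columns as a list. -/
def BasisIdx.cols (B : BasisIdx) : List ColRef := [B.c₀, B.c₁, B.c₂, B.c₃, B.c₄, B.c₅]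

/-- The table data of one column (`none` if the index is out of range), read exactly as 110E `BasisCert.rows?` reads it. -/
def colEntry? (c : ColRef) : Option ((Fin 3 × Bool → ℚ) × ℚ) := T75Q[c.k]?

/-- The 6×6 basis matrix `M(p, i) = e_i (relabel g_i s_i p)` (rows = slots in `cegSlot6` order, columns = the basis columns) — the matrix whose
product with the rows `r_i` 110E `invCheck` compares with the identity — or `none` if a column index is out of range. -/
def BasisIdx.mat? (B : BasisIdx) : Option (List (List ℚ)) :=
  match B.cols.mapM colEntry? with
  | none => none
  | some es => some (cegSlot6.map (fun p => (List.zip B.cols es).map (fun ce => ce.2.1 (relabel ce.1.g ce.1.s p))))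

/-- A list of six rationals (in `cegSlot6` order) as a slot function; missing entries read as `0`. -/
def slimRowFun (r : List ℚ) : Fin 3 × Bool → ℚ := sextQ (r.getD 0 0) (r.getD 1 0) (r.getD 2 0) (r.getD 3 0) (r.getD 4 0) (r.getD 5 0)

/-- ★ EXPANSION: the 110B `BasisCert` with the same columns and the rows of the exact inverse `M⁻¹` (zero rows if `M` is singular or a column is
out of range — 110E `invCheck` then rejects the basis, so the fallback is harmless). -/
def BasisIdx.expand (B : BasisIdx) : BasisCert :=
  match (match B.mat? with | none => none | some M => gjInverseZ M) with
  | some inv => ⟨B.c₀, B.c₁, B.c₂, B.c₃, B.c₄, B.c₅, slimRowFun (inv.getD 0 []), slimRowFun (inv.getD 1 []), slimRowFun (inv.getD 2 []),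
      slimRowFun (inv.getD 3 []), slimRowFun (inv.getD 4 []), slimRowFun (inv.getD 5 [])⟩
  | none => ⟨B.c₀, B.c₁, B.c₂, B.c₃, B.c₄, B.c₅, 0, 0, 0, 0, 0, 0⟩

/-- Expansion of a list of slim bases (the `bases` field of a 110E `StationCert` / 113F `CellPart`). -/
def expandAll (Bs : List BasisIdx) : List BasisCert := Bs.map BasisIdx.expand

/-- ★ COMPACT ROW ENCODING (the byte-only alternative, no kernel inversion): a row of `B⁻¹` as six integer numerators over ONE common
denominator, `cegRowZ n₀ n₁ n₂ n₃ n₄ n₅ D = sextQ (n₀/D) … (n₅/D)` — half the bytes of six reduced fractions, same kernel cost. -/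
def cegRowZ (n₀ n₁ n₂ n₃ n₄ n₅ : ℤ) (D : ℕ) : Fin 3 × Bool → ℚ :=
  sextQ (Rat.divInt n₀ D) (Rat.divInt n₁ D) (Rat.divInt n₂ D) (Rat.divInt n₃ D) (Rat.divInt n₄ D) (Rat.divInt n₅ D)

/-- sanity: `cegRowZ 1 (-2) 3 0 0 6 4` reads `1/4, -1/2, 3/4, 0, 0, 3/2`. -/
theorem rowZ_example : (cegSlot6.map (cegRowZ 1 (-2) 3 0 0 6 4)) = [1/4, -1/2, 3/4, 0, 0, 3/2] := by decide +kernel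

/-- The slim form of an existing basis certificate (drops the shipped inverse). -/
def BasisCert.slim (B : BasisCert) : BasisIdx := ⟨B.c₀, B.c₁, B.c₂, B.c₃, B.c₄, B.c₅⟩

/-- [formal bookkeeping] expansion keeps the columns. -/
theorem BasisIdx.expand_c₀ (B : BasisIdx) : B.expand.c₀ = B.c₀ := by
  unfold BasisIdx.expand; split <;> rfl

end Summit.AtomisticToContinuum.Crystallization.Theorems.ChargedEnergyGapChartDial
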